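import Mathlib
import Summits.KontsevichZagierPeriods.Zeta5Search.PalindromicVDigits
import Summits.KontsevichZagierPeriods.Zeta5Search.MixedPairTermwiseProof
import Summits.KontsevichZagierPeriods.Zeta5Search.UniversalDigitCells
import Summits.KontsevichZagierPeriods.Zeta5Search.RecordCellAAtlasNotMin
import HarnessLib

/-!
# ζ(5) search — the DOUBLE-DROP BONUS is a THEOREM (`DoubleDropBonus`, gen-2 g9 REPORT §10)

Cell `pub-zeta5` (HONEST FRAMING: systematic search; no irrationality claim unless certified), typer seat
generation 9.  Discharges BY NAME `DoubleDropBonus` (`Zeta5Search/UniversalDigitCells.lean`, appended v6): in regimes H0/T with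
`N = −m ≥ 3` EVEN, if every class at level `−N` is a tame single-pole class or centre-free with palindromic exponent vector (and
every deeper class is tame single-pole), then `v_p(Cas_j(b)) ≥ casLB + 2` for `p ≤ d(b)`.

PROOF (gen-2's).  For `b' ∈ {b, b + e_j}`: `v(𝒦_p(b')) ≥ 4 − N` classwise — single-pole classes `≥ 1`, classes above `−N` `≥ 3 + E_x`,
deep palindromic classes have `ĉ_x = 0` (`cHat_eq_zero_of_pal`) hence `≥ E_x + 4` by U-K (`kDigit_holds`); `v(V(b')) ≥ 1 − N` — classes
above `−N` by `ν_x ≥ E_x`, tame classes by `ν_x ≥ 0`, and the deep palindromic classes in conjugate PAIRS (`padicNorm_classV_pair_le`: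
U-V + G2 + `v̂_{x̄} = v̂_x`), the set of such classes being closed under conjugation.  The hypotheses pass from `b` to `b + e_j`
(classes hit by the shift rise by `≥ 1`; unhit classes keep their net exponents, `netExp_shift_eq_of_classExp_eq`; tameness persists,
`classNu_shift_ge`).  Finally `Cas_j = −(𝒦(b⁺)V(b) − 𝒦(b)V(b⁺))` for `p ≤ d` (`casoratian_split`, `omegaRes_eq_zero`), so
`v(Cas_j) ≥ 5 − 2N ≥ casLB + 2` (`casLB ≤ ν_{x*} + 3 + E_{x*} = 3 − 2N` at a deep multipole class).  `p`-adic valuations of rationals;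
nothing about irrationality.
-/

noncomputable section

open Finset

namespace Summit.KontsevichZagierPeriods.Zeta5Search.ClusterValuation

open Summit.KontsevichZagierPeriods.Zeta5Search.DualSeries (InBox)
open Summit.KontsevichZagierPeriods.Zeta5Search.WedgeDictionary (coeffV dOf)
open Summit.KontsevichZagierPeriods.Zeta5Search.CasoratianValuation (InPolytope shift casoratian)
open Summit.KontsevichZagierPeriods.Zeta5Search.BigPrime (shift_zero)
open Summit.KontsevichZagierPeriods.Zeta5Search.PadicSeries

variable {p : ℕ} [hp : Fact p.Prime]

omit hp in
/-- A class with `ν_x ≥ 0 > E_x` has exactly one pole. -/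
theorem classPoleCount_eq_one_of_classNu (b : ℕ → ℤ) {p x : ℕ} (hnu : 0 ≤ classNu b p x) (hE : classExp b p x < 0) :
    classPoleCount b p x = 1 := by
  unfold classNu at hnu
  split_ifs at hnu with h
  · exact h.1
  · omega

/-! ### The `𝒦`-side: `v(𝒦_p) ≥ 4 − N` -/

/-- **`‖𝒦_p(b)‖ ≤ p^{−(4−N)}`** when every pole class with `E_x ≤ −N` is tame-or-single (`ν_x ≥ 0`) or deep, centre-free and
palindromic (`N ≥ 3` even). -/
theorem padicNorm_kRes_le_dd (b : ℕ → ℤ) (hb : InPolytope b) (hp5 : 5 ≤ p) (hwin : (b 0 + 2 : ℤ) < (p : ℤ) ^ 2)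
    {N : ℕ} (hN : 3 ≤ N) (hNe : Even N)
    (hH : ∀ x, x < p → 1 ≤ classPoleCount b p x → classExp b p x ≤ -(N : ℤ) →
      0 ≤ classNu b p x ∨ (classExp b p x = -(N : ℤ) ∧ ¬ CentreIn b p x ∧
        ∀ s ∈ classSet b p x, netExp b s = netExp b ((b 0).toNat - ((b 0).toNat - x) % p - (s - x)))) :
    padicNorm p (kRes b p) ≤ (p : ℚ) ^ (-(4 - (N : ℤ))) := by
  have hprime := hp.out
  rw [kRes_eq_sum_classK b hprime.pos]
  refine padicNorm.sum_le' (fun x hx => ?_) (zpow_p_nonneg _)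
  have hx' := mem_range.1 hx
  rcases Nat.eq_zero_or_pos (classPoleCount b p x) with h0 | hpos
  · rw [classK_eq_zero_of_noPole b hb h0, padicNorm.zero]; exact zpow_p_nonneg _
  by_cases hE : classExp b p x ≤ -(N : ℤ)
  · rcases hH x hx' hpos hE with hnu | ⟨hEN, hcx, hpal⟩
    · have h1 := classPoleCount_eq_one_of_classNu b hnu (by omega)
      exact (padicNorm_classK_le_single b hb hp5 hwin hx' h1).trans (zpow_le_zpow_right₀ one_le_p (by omega))
    · obtain ⟨q, hq⟩ := card_pos.1 (by unfold classPoleCount at hpos; omega :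
        0 < ((classSet b p x).filter fun s => netExp b s < 0).card)
      obtain ⟨hqC, hqpole⟩ := mem_filter.1 hq
      have heven : Even (classExp b p x) := by
        obtain ⟨k, hk⟩ := hNe
        exact ⟨-(k : ℤ), by rw [hEN, hk]; push_cast; ring⟩
      have hc0 := cHat_eq_zero_of_pal b hb hprime hp5 hwin hx' hcx hpal (by omega) heven
      have hdig := kDigit_holds b p x q hb hprime hp5 hwin hx' hqC hqpole (by omega)
      rw [hc0, mul_zero, sub_zero] at hdig
      refine padicNorm_le_of_val fun hne => ?_
      have := hdig hne
      omega
  · exact (padicNorm_classK_le_multi b hb hp5 hwin hx' hpos).trans (zpow_le_zpow_right₀ one_le_p (by omega))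

/-! ### The `V`-side: `v(V) ≥ 1 − N` -/

/-- The set of deep centre-free palindromic classes is closed under conjugation. -/
theorem pal_conj (b : ℕ → ℤ) (h0 : 0 ≤ b 0) {p x : ℕ} (hp0 : 0 < p) (hx : x < p) (hpn : p ≤ (b 0).toNat)
    (hpal : ∀ s ∈ classSet b p x, netExp b s = netExp b ((b 0).toNat - ((b 0).toNat - x) % p - (s - x))) :
    ∀ s ∈ classSet b p (conjClass b p x),
      netExp b s = netExp b ((b 0).toNat - ((b 0).toNat - conjClass b p x) % p - (s - conjClass b p x)) := by
  intro s hs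
  set n := (b 0).toNat with hn
  have hxn : x ≤ n := by omega
  have hsn : s ≤ n := le_of_mem_classSet b hs
  have hcc : (n - conjClass b p x) % p = x := conjClass_conjClass b hx hpn
  have hxc : conjClass b p x < p := conjClass_lt b hp0 x
  -- `n − s` lies in the class of `x`
  have hs' : n - s ∈ classSet b p x := (mem_classSet_conj_iff b hxn hsn).1 hs
  have hres' : (n - s) % p = x := by rw [(mem_filter.1 hs').2, Nat.mod_eq_of_lt hx]
  have hres : s % p = conjClass b p x := by rw [(mem_filter.1 hs).2, Nat.mod_eq_of_lt hxc]
  have hb1 : x ≤ n - s := by rw [← hres']; exact Nat.mod_le _ _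
  have hb2 : conjClass b p x ≤ s := by rw [← hres]; exact Nat.mod_le _ _
  have hb3 : conjClass b p x ≤ n - x := by unfold conjClass; exact Nat.mod_le _ _
  -- the reflection inside the class of `x`, applied to `n − s`
  obtain ⟨hmem, -, -, -⟩ := palTau_class b hp0 hx hs'
  have hτn : n - (n - x) % p - (n - s - x) ≤ n := le_of_mem_classSet b hmem
  have hpos : n - (n - conjClass b p x) % p - (s - conjClass b p x) = n - (n - (n - x) % p - (n - s - x)) := by
    rw [hcc]
    show n - x - (s - conjClass b p x) = n - (n - conjClass b p x - (n - s - x))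
    omega
  rw [hpos, netExp_reflect b h0 hτn, ← hpal (n - s) hs', netExp_reflect b h0 hsn]

/-- **`‖V(b)‖ ≤ p^{−(1−N)}`** under the same hypotheses (`N` even, `p ≤ b₀`). -/
theorem padicNorm_coeffV_le_dd (b : ℕ → ℤ) (hb : InPolytope b) (hp5 : 5 ≤ p) (hpn : p ≤ (b 0).toNat)
    (hwin : (b 0 + 2 : ℤ) < (p : ℤ) ^ 2) {N : ℕ} (hN : 3 ≤ N) (hNe : Even N)
    (hH : ∀ x, x < p → 1 ≤ classPoleCount b p x → classExp b p x ≤ -(N : ℤ) →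
      0 ≤ classNu b p x ∨ (classExp b p x = -(N : ℤ) ∧ ¬ CentreIn b p x ∧
        ∀ s ∈ classSet b p x, netExp b s = netExp b ((b 0).toNat - ((b 0).toNat - x) % p - (s - x)))) :
    padicNorm p (coeffV b) ≤ (p : ℚ) ^ (-(1 - (N : ℤ))) := by
  classical
  have hprime := hp.out
  have hp0 : 0 < p := hprime.pos
  have h0 : 0 ≤ b 0 := hb.1.1
  -- the deep centre-free palindromic pole classes
  set A := (range p).filter (fun x => 1 ≤ classPoleCount b p x ∧ classExp b p x = -(N : ℤ) ∧ ¬ CentreIn b p x ∧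
    ∀ s ∈ classSet b p x, netExp b s = netExp b ((b 0).toNat - ((b 0).toNat - x) % p - (s - x))) with hA
  -- single classes outside `A`
  have hsingle : ∀ x, x < p → x ∉ A → padicNorm p (classV b p x) ≤ (p : ℚ) ^ (-(1 - (N : ℤ))) := by
    intro x hx hxA
    rcases Nat.eq_zero_or_pos (classPoleCount b p x) with hc0 | hpos
    · rw [classV_eq_zero_of_noPole b hb hc0, padicNorm.zero]; exact zpow_p_nonneg _
    have hnu := CellA.classExp_le_classNu b p x
    refine (padicNorm_classV_le b hb hp5 hwin hx hpos).trans (zpow_le_zpow_right₀ one_le_p ?_)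
    by_cases hE : classExp b p x ≤ -(N : ℤ)
    · rcases hH x hx hpos hE with hnu0 | hdp
      · omega
      · exact absurd (mem_filter.2 ⟨mem_range.2 hx, hpos, hdp⟩) hxA
    · omega
  rw [coeffV_eq_sum_classV b hp0, ← sum_filter_add_sum_filter_not (range p) (fun x =>
    1 ≤ classPoleCount b p x ∧ classExp b p x = -(N : ℤ) ∧ ¬ CentreIn b p x ∧
    ∀ s ∈ classSet b p x, netExp b s = netExp b ((b 0).toNat - ((b 0).toNat - x) % p - (s - x)))]
  refine (padicNorm.nonarchimedean (p := p)).trans (max_le ?_ ?_)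
  · -- the palindromic classes, in conjugate pairs
    have hmem : ∀ x ∈ A, x < p ∧ 1 ≤ classPoleCount b p x ∧ classExp b p x = -(N : ℤ) ∧ ¬ CentreIn b p x ∧
        ∀ s ∈ classSet b p x, netExp b s = netExp b ((b 0).toNat - ((b 0).toNat - x) % p - (s - x)) :=
      fun x hx => by
        obtain ⟨hxr, h⟩ := mem_filter.1 hx
        exact ⟨mem_range.1 hxr, h⟩
    have hmapsA : ∀ x ∈ A, conjClass b p x ∈ A := by
      intro x hx
      obtain ⟨hx', hc, hE, hcx, hpal⟩ := hmem x hx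
      refine mem_filter.2 ⟨mem_range.2 (conjClass_lt b hp0 x), ?_, ?_, ?_, pal_conj b h0 hp0 hx' hpn hpal⟩
      · rwa [classPoleCount_conj b h0 (by omega)]
      · rwa [classExp_conj b h0 (by omega)]
      · rwa [centreIn_conj_iff b h0 (by omega)]
    have hinv : ∀ x ∈ A, conjClass b p (conjClass b p x) = x := fun x hx =>
      conjClass_conjClass b (hmem x hx).1 hpn
    have hpair : ∑ x ∈ A, classV b p (conjClass b p x) = ∑ x ∈ A, classV b p x :=
      sum_nbij' (conjClass b p) (conjClass b p) hmapsA hmapsA hinv hinv (fun _ _ => rfl)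
    have h2 : (2 : ℚ) * ∑ x ∈ A, classV b p x = ∑ x ∈ A, (classV b p x + classV b p (conjClass b p x)) := by
      rw [sum_add_distrib, hpair, two_mul]
    have hn2 : padicNorm p (2 : ℚ) = 1 := by
      have := (padicNorm.nat_eq_one_iff (p := p) 2).2 (by
        intro h; have := (Nat.prime_dvd_prime_iff_eq hprime Nat.prime_two).1 h; omega)
      exact_mod_cast this
    calc padicNorm p (∑ x ∈ A, classV b p x)
        = padicNorm p ((2 : ℚ) * ∑ x ∈ A, classV b p x) := by rw [padicNorm.mul, hn2, one_mul]
      _ = padicNorm p (∑ x ∈ A, (classV b p x + classV b p (conjClass b p x))) := by rw [h2]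
      _ ≤ (p : ℚ) ^ (-(1 - (N : ℤ))) := by
        refine padicNorm.sum_le' (fun x hx => ?_) (zpow_p_nonneg _)
        obtain ⟨hx', hc, hE, hcx, hpal⟩ := hmem x hx
        have heven : Even (classExp b p x) := by
          obtain ⟨k, hk⟩ := hNe
          exact ⟨-(k : ℤ), by rw [hE, hk]; push_cast; ring⟩
        have h := padicNorm_classV_pair_le b hb hp5 hpn hwin hx' hc hcx hpal heven
        rwa [hE, show -(-(N : ℤ) + 1) = -(1 - (N : ℤ)) by ring] at h
  · refine padicNorm.sum_le' (fun x hx => ?_) (zpow_p_nonneg _)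
    obtain ⟨hxr, hnot⟩ := mem_filter.1 hx
    exact hsingle x (mem_range.1 hxr) (fun h => hnot (mem_filter.1 h).2)

/-! ### The class bound at a deep multipole class -/

omit hp in
/-- `casLB ≤ 3 − 2N` when a multipole class has `E_x = −N`. -/
theorem casLB_le_of_deep (b : ℕ → ℤ) {N : ℕ} {x : ℕ} (hx : x ∈ multipoleClasses b p) (hE : classExp b p x = -(N : ℤ)) :
    casLB b p ≤ 3 - 2 * (N : ℤ) := by
  obtain ⟨hxr, hmulti⟩ := mem_filter.1 hx
  have hx' := mem_range.1 hxr
  obtain ⟨v, hv⟩ := vbMin_isSome b hx' (by omega)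
  obtain ⟨r, hr⟩ := rowMin_isSome b hx' (by omega)
  have h1 := vbMin_le b hv hx' (by omega)
  have h2 := rowMin_le_multi b hr hx' hmulti
  have hnu : classNu b p x = classExp b p x := by
    unfold classNu; rw [if_neg (by omega)]
  unfold casLB
  rw [hv, hr]
  simp only
  omega

/-! ### The hypotheses for `b` and for `b + e_j` -/

section Transport

variable (b : ℕ → ℤ) {j N : ℕ} (hb : InPolytope b) (hj1 : 1 ≤ j) (hp0 : 0 < p)
  (hT : ∀ x, x < p → classExp b p x < -(N : ℤ) → classPoleCount b p x = 1 ∧ tameSingle b p x = true)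
  (hD : ∀ x ∈ deepClasses b p N, (classPoleCount b p x = 1 ∧ tameSingle b p x = true) ∨
    (¬ CentreIn b p x ∧ (∀ s ∈ classSet b p x, netExp b s = netExp b ((b 0).toNat - ((b 0).toNat - x) % p - (s - x)))))
include hT hD

omit hp in
/-- The hypotheses of the core lemmas hold for `b`. -/
theorem ddHyp_self : ∀ x, x < p → 1 ≤ classPoleCount b p x → classExp b p x ≤ -(N : ℤ) →
    0 ≤ classNu b p x ∨ (classExp b p x = -(N : ℤ) ∧ ¬ CentreIn b p x ∧
      ∀ s ∈ classSet b p x, netExp b s = netExp b ((b 0).toNat - ((b 0).toNat - x) % p - (s - x))) := by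
  intro x hx _ hE
  rcases lt_or_eq_of_le hE with hlt | heq
  · left
    obtain ⟨h1, h2⟩ := hT x hx hlt
    unfold classNu; rw [if_pos ⟨h1, h2⟩]; exact le_max_right _ _
  · rcases hD x (mem_filter.2 ⟨mem_range.2 hx, heq⟩) with ⟨h1, h2⟩ | ⟨hcx, hpal⟩
    · left; unfold classNu; rw [if_pos ⟨h1, h2⟩]; exact le_max_right _ _
    · exact Or.inr ⟨heq, hcx, hpal⟩

include hb hj1 hp0 in
omit hp in
/-- The hypotheses of the core lemmas hold for `b + e_j`. -/
theorem ddHyp_shift : ∀ x, x < p → 1 ≤ classPoleCount (shift b j) p x → classExp (shift b j) p x ≤ -(N : ℤ) →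
    0 ≤ classNu (shift b j) p x ∨ (classExp (shift b j) p x = -(N : ℤ) ∧ ¬ CentreIn (shift b j) p x ∧
      ∀ s ∈ classSet (shift b j) p x, netExp (shift b j) s =
        netExp (shift b j) (((shift b j) 0).toNat - (((shift b j) 0).toNat - x) % p - (s - x))) := by
  intro x hx hpos hE'
  have hEge := classExp_shift_ge b hb.1 hj1 p x
  have hnuge := classNu_shift_ge b hb.1 hj1 hpos
  rcases lt_or_eq_of_le (show classExp b p x ≤ -(N : ℤ) by omega) with hlt | heq
  · left
    obtain ⟨h1, h2⟩ := hT x hx hlt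
    have : 0 ≤ classNu b p x := by unfold classNu; rw [if_pos ⟨h1, h2⟩]; exact le_max_right _ _
    omega
  · have hEeq : classExp (shift b j) p x = classExp b p x := by omega
    rcases hD x (mem_filter.2 ⟨mem_range.2 hx, heq⟩) with ⟨h1, h2⟩ | ⟨hcx, hpal⟩
    · left
      have : 0 ≤ classNu b p x := by unfold classNu; rw [if_pos ⟨h1, h2⟩]; exact le_max_right _ _
      omega
    · right
      refine ⟨by omega, by rw [centreIn_shift b hj1]; exact hcx, ?_⟩
      have hnet := netExp_shift_eq_of_classExp_eq b hb.1 hj1 hEeq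
      intro s hs
      rw [classSet_shift b hj1] at hs
      rw [shift_zero b hj1, hnet s hs, hnet _ (palTau_class b hp0 hx hs).1]
      exact hpal s hs

end Transport

/-! ### The double-drop bonus -/

/-- **`DoubleDropBonus` is a theorem.** -/
theorem doubleDropBonus_holds : DoubleDropBonus := by
  intro b p j N hb hb' hj1 hj7 hprime hp5 hpb hpd hwin hN hNe hT hM hD hcas
  haveI : Fact p.Prime := ⟨hprime⟩
  have hp0 : 0 < p := hprime.pos
  have hp1 : (1 : ℚ) ≤ p := one_le_p
  have h0 : 0 ≤ b 0 := hb.1.1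
  have hpn : p ≤ (b 0).toNat := by
    have : (((b 0).toNat : ℕ) : ℤ) = b 0 := Int.toNat_of_nonneg h0
    omega
  have hwin' : (shift b j 0 + 2 : ℤ) < (p : ℤ) ^ 2 := by rwa [shift_zero b hj1]
  have hpn' : p ≤ (shift b j 0).toNat := by rwa [shift_zero b hj1]
  -- the four norms
  have hHb := ddHyp_self b hT hD
  have hHb' := ddHyp_shift b hb hj1 hp0 hT hD
  have hK := padicNorm_kRes_le_dd b hb hp5 hwin hN hNe hHb
  have hK' := padicNorm_kRes_le_dd (shift b j) hb' hp5 hwin' hN hNe hHb'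
  have hV := padicNorm_coeffV_le_dd b hb hp5 hpn hwin hN hNe hHb
  have hV' := padicNorm_coeffV_le_dd (shift b j) hb' hp5 hpn' hwin' hN hNe hHb'
  -- the `Ω`-bracket vanishes for `p ≤ d`
  have hΩ : omegaRes b p = 0 := omegaRes_eq_zero b hb (by omega)
  have hΩ' : omegaRes (shift b j) p = 0 :=
    omegaRes_eq_zero (shift b j) hb' (by rw [BigPrime.dOf_shift b hj1 hj7]; omega)
  -- the class bound at the deep multipole class
  obtain ⟨x, hx, hxE⟩ := hM
  have hLB := casLB_le_of_deep b hx hxE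
  apply val_ge_of_padicNorm_le hcas
  rw [casoratian_split b j p, hΩ, hΩ', zero_mul, zero_mul, sub_zero, zero_sub, padicNorm.neg]
  refine ((padicNorm.sub (p := p)).trans (max_le (padicNorm_mul_le hK' hV) (padicNorm_mul_le hK hV'))).trans
    (zpow_le_zpow_right₀ hp1 (by omega))

end Summit.KontsevichZagierPeriods.Zeta5Search.ClusterValuation

end
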